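import Summits.QuantumFields.BalabanUV.Beta.FP.MixVertexLimit

/-!
# `BalabanUV.Beta.FP.ResponseVertexLipschitz` — road «FP» for binder row D1, `RESIDUAL-FP.md` ROW #14 ∕ R-FP-41 (b) (owner, gen 10): LIPSCHITZ LETTERS OF THE
# SECOND-RESPONSE CARRIERS — the multiplier-column vertex `vertexOfM` (coarse-localised tables), the operator derivative `dM`, the sandwich `−K∘V∘K`, and the
# derivative of the inverse `K2OfK` — in `(K, S, M)`; the difference twins of Literature `SecondOrderResponse.vertexFamily_vertexOfM ∕ vertexFamily_dM ∕
# biLoc_sandwich ∕ vertexFamily_K2OfK` (uniform versions).  The fourth summand `dM ∘ K2OfK` of `W2OfK` is assembled from these in `FP/ResponseVertexLimit`.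

HONEST DEPENDENCY (page 1, mandatory): continuum YM on T⁴ ⇐ BetaPertH ∧ nine spine estimates (0/9 proved); BetaPertH ⇐ (D1) ∧ (D4) ∧ CAP+tail;
G-an2-4 gates asym, D1 and NE2/3/4.  HONEST FRAMING (cell contract, verbatim): «discharging `BetaPertH` makes Bałaban's UV stability UNCONDITIONAL —
a real constructive-QFT result; it is NOT the continuum limit and NOT the Clay problem.»  THIS MODULE is [folklore] kernel bookkeeping (absolutely
convergent lattice sums, explicit constants; no `def`, no `def … : Prop`, nothing cited, 0 sorry).  Every bound below is about ABSTRACT kernels and tables with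
displayed localisation letters; asserted for no object of Bałaban's.  0∕4 row-D1 binders; NOT X1, NOT (G8), NOT (ASYMP), NOT D1, NOT BetaPertH, NOT continuum,
NOT Clay.  «not in print; our bookkeeping».

ABSOLUTE RULE (cell charter, verbatim): «No internally-minted statement may enter as a cited fact. Every hypothesis is either kernel-proved in this package or a
verbatim quotation of a PUBLISHED theorem with page reference. The manuscript(s) under audit are NOT citable for their own disputed steps — they are the thing
under adjudication; programme-internal (2001/route/tribunal) claims are never citable.»

CONTENT (`D = d + 1`, blocking `N`; `Decays K C m`, `LocStencil S Cs m`, `VertexFamily M N CM m` — the multiplier tables localised at their coarse bonds).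
* §1 [folklore] `biLoc_onLat_self(_sub)` (extension by zero of coarse-localised families), **`biLoc_cwsum_sub_self`** (Lipschitz of the coarse superposition with
  SELF-localised kernels: asym1's `HessKerRate.biLoc_wsum_sub_wsum` after `onLat`), **`vertexFamily_vertexOfM_sub`** (the multiplier-column vertex is Lipschitz in
  `(K, M)`), **`vertexFamily_dM_sub`** (`dM` is Lipschitz in `(K, S, M)`: `vertexFamily_vertexOfK_sub` + the former).
* §2 [folklore] **`biLoc_sandwich_sub`**: `−K∘V∘K + K′∘V′∘K′` is bi-localised at `(p, q)` (rate `m/4`) with constant linear in `(εK, εV)` — the telescoping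
  `K∘V∘K − K′∘V′∘K′ = (K−K′)∘V∘K + K′∘(V−V′)∘K + K′∘V′∘(K−K′)` through `KernelWard.comp_sub_left∕right` (summability from `ExpKernelCalculus.summable_compTerm` and
  `KernelWard.summable_slice_biLoc_bdd`), bounds by `biLoc_comp_decays`∕`biLoc_comp_right`.
* §3 [folklore] **`vertexFamily_K2OfK_sub`**: the derivative of the inverse is Lipschitz in `(K, S, M)` as a vertex family (rate `m/8`).
Provenance: road FP OWNER b2b-balaban-beta-d1-p3 gen 10 (prover-b2b-balaban-beta-d1-p3-g10-0), 2026-08-21, row #14 ∕ R-FP-41 (b).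
-/

noncomputable section

namespace Summit.QuantumFields.BalabanUV.Beta.FP.ResponseVertexLipschitz

open Literature.MathematicalPhysics.QuantumFieldTheory
open Literature.MathematicalPhysics.QuantumFieldTheory.Balaban1983to89
open Literature.MathematicalPhysics.QuantumFieldTheory.Balaban1983to89.Beta
open Literature.Probability.LatticeModels (Torus.proj)
open LatticeForm (quo)
open B12Sec2to5 (l1 l1_nonneg)
open ExpKernelCalculus (MKer Decays BiLoc VertexFamily comp Zl Zl_nonneg biLoc_comp_decays summable_compTerm)
open OneStepResolventKernel (Fib LocStencil wsum biLoc_finset_sum eq_zsmul_quo_of_proj decays_mono biLoc_mono)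
open OneStepKernelFamily (colH vertexOfK vertexFamily_vertexOfK)
open InterLevelTransport (onLat onLat_off cwsum)
open SecondOrderResponse (colM vertexOfM dM K2OfK vertexFamily_vertexOfM vertexFamily_dM biLoc_neg)
open KernelWard (Bdd bdd_of_decays biLoc_add comp_sub_left comp_sub_right summable_slice_biLoc_bdd)
open BalabanStepJetsSucc (biLoc_comp_right)
open HessKerRate (biLoc_wsum_sub_wsum vertexFamily_vertexOfK_sub)
open Summit.QuantumFields.BalabanUV.Beta.FP.MixVertexLimit (abs_onLat_le abs_colM_le)

variable {d : ℕ}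

/-! ## §1 The multiplier-column vertex and `dM` are Lipschitz in `(K, S, M)` -/

section VertexM

variable {N : ℕ} [NeZero N]

/-- [folklore] Extension by zero of a coarse family localised at its own coarse point: `onLat N Q` is localised at its own FINE index. -/
theorem biLoc_onLat_self {Q : (Fin (d + 1) → ℤ) → MKer (d + 1) (Fib d)} {C δ : ℝ} (hQ : ∀ w, BiLoc (Q w) ((N : ℤ) • w) ((N : ℤ) • w) C δ)
    (v : Fin (d + 1) → ℤ) : BiLoc (onLat N Q v) v v C δ := by
  have hC : 0 ≤ C := (hQ 0).nonneg (Sum.inl 0)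
  by_cases hv : Torus.proj N v = 0
  · have e := eq_zsmul_quo_of_proj (N := N) hv
    simp only [onLat, hv, if_true]
    have h := hQ (quo N v)
    rwa [← e] at h
  · intro x z a b
    rw [onLat_off Q hv]
    show |(0 : ℝ)| ≤ _
    rw [abs_zero]
    positivity

/-- [folklore] The same for the DIFFERENCE of two coarse families (the extension by zero is additive). -/
theorem biLoc_onLat_self_sub {Q Q' : (Fin (d + 1) → ℤ) → MKer (d + 1) (Fib d)} {ε δ : ℝ}
    (hQQ : ∀ w, BiLoc (Q w - Q' w) ((N : ℤ) • w) ((N : ℤ) • w) ε δ) (v : Fin (d + 1) → ℤ) :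
    BiLoc (onLat N Q v - onLat N Q' v) v v ε δ := by
  have h := biLoc_onLat_self (N := N) (Q := fun w => Q w - Q' w) hQQ v
  by_cases hv : Torus.proj N v = 0
  · simpa only [onLat, hv, if_true] using h
  · simpa only [onLat_off _ hv, sub_zero] using h

/-- [folklore] The difference of two extended weight families is the extension of the difference (pointwise bound). -/
theorem abs_onLat_sub_le {w w' : (Fin (d + 1) → ℤ) → ℝ} {ε m : ℝ} {p : Fin (d + 1) → ℤ}
    (hww : ∀ y, |w y - w' y| ≤ ε * Real.exp (-m * l1 ((N : ℤ) • y - p))) (v : Fin (d + 1) → ℤ) :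
    |onLat N w v - onLat N w' v| ≤ ε * Real.exp (-m * l1 (v - p)) := by
  have h := abs_onLat_le (N := N) (w := fun y => w y - w' y) hww v
  by_cases hv : Torus.proj N v = 0
  · simpa only [onLat, hv, if_true] using h
  · simpa only [onLat_off _ hv, sub_zero] using h

/-- [folklore] **THE COARSE SUPERPOSITION IS LIPSCHITZ IN (weights, kernels)** for kernels localised at their own coarse points: weights decaying from `p` (rate `δ`,
constants `C, C′`, difference `εw`), kernels `VertexFamily`-type at rate `δ` (constants `Cq, Cq′`, difference `εQ`) ⟹
`BiLoc (cwsum N w Q − cwsum N w′ Q′) p p ((εw·Cq + C′·εQ)·Zl(δ/2)) (δ/2)` (asym1's `biLoc_wsum_sub_wsum` after extension by zero). -/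
theorem biLoc_cwsum_sub_self {w w' : (Fin (d + 1) → ℤ) → ℝ} {Q Q' : (Fin (d + 1) → ℤ) → MKer (d + 1) (Fib d)} {C C' Cq Cq' εw εQ δ : ℝ}
    {p : Fin (d + 1) → ℤ}
    (hw : ∀ y, |w y| ≤ C * Real.exp (-δ * l1 ((N : ℤ) • y - p))) (hw' : ∀ y, |w' y| ≤ C' * Real.exp (-δ * l1 ((N : ℤ) • y - p)))
    (hww : ∀ y, |w y - w' y| ≤ εw * Real.exp (-δ * l1 ((N : ℤ) • y - p)))
    (hQ : ∀ y, BiLoc (Q y) ((N : ℤ) • y) ((N : ℤ) • y) Cq δ) (hQ' : ∀ y, BiLoc (Q' y) ((N : ℤ) • y) ((N : ℤ) • y) Cq' δ)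
    (hQQ : ∀ y, BiLoc (Q y - Q' y) ((N : ℤ) • y) ((N : ℤ) • y) εQ δ) (hδ : 0 < δ) :
    BiLoc (cwsum N w Q - cwsum N w' Q') p p ((εw * Cq + C' * εQ) * Zl (d + 1) (δ / 2)) (δ / 2) := by
  have hC : 0 ≤ C := le_of_mul_le_mul_right ((abs_nonneg _).trans (hw 0) |>.trans_eq' (by ring)) (Real.exp_pos _)
  have hC' : 0 ≤ C' := le_of_mul_le_mul_right ((abs_nonneg _).trans (hw' 0) |>.trans_eq' (by ring)) (Real.exp_pos _)
  have hεw : 0 ≤ εw := le_of_mul_le_mul_right ((abs_nonneg _).trans (hww 0) |>.trans_eq' (by ring)) (Real.exp_pos _)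
  exact biLoc_wsum_sub_wsum (abs_onLat_le hw) (abs_onLat_le hw') (abs_onLat_sub_le hww) (biLoc_onLat_self hQ) (biLoc_onLat_self hQ')
    (biLoc_onLat_self_sub hQQ) hδ hC hC' hεw

/-- [folklore] **THE MULTIPLIER-COLUMN VERTEX IS LIPSCHITZ IN `(K, M)`**: for `K, K′` decaying at rate `δK` (difference `εK`) and multiplier tables `M, M′`
(`VertexFamily … N · δ`, `δ ≤ δK`, difference `εM`): `VertexFamily (vertexOfM K N M − vertexOfM K′ N M′) N ((d+1)·((εK·CM + C′·εM)·Zl(δ/2))) (δ/2)` —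
the difference twin of `SecondOrderResponse.vertexFamily_vertexOfM`. -/
theorem vertexFamily_vertexOfM_sub {K K' : MKer (d + 1) (Fib d)} {C C' εK δK : ℝ} (hK : Decays K C δK) (hK' : Decays K' C' δK)
    (hKK : Decays (K - K') εK δK) {M M' : Fin (d + 1) → (Fin (d + 1) → ℤ) → MKer (d + 1) (Fib d)} {CM CM' εM δ : ℝ}
    (hM : VertexFamily M N CM δ) (hM' : VertexFamily M' N CM' δ) (hMM : VertexFamily (M - M') N εM δ) (hδ : 0 < δ) (hδK : δ ≤ δK) :
    VertexFamily (vertexOfM K N M - vertexOfM K' N M') N ((d + 1 : ℕ) * ((εK * CM + C' * εM) * Zl (d + 1) (δ / 2))) (δ / 2) := by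
  intro μ y
  have hC : 0 ≤ C := hK.nonneg (Sum.inl 0)
  have hC' : 0 ≤ C' := hK'.nonneg (Sum.inl 0)
  have hεK : 0 ≤ εK := hKK.nonneg (Sum.inl 0)
  have hw : ∀ (ρ : Fin (d + 1)) (w : Fin (d + 1) → ℤ), |colM K N μ y ρ w| ≤ C * Real.exp (-δ * l1 ((N : ℤ) • w - (N : ℤ) • y)) :=
    fun ρ w => OneStepResolventKernel.bound_mono (abs_colM_le (N := N) hK μ y ρ w) hC le_rfl hδK (l1_nonneg _)
  have hw' : ∀ (ρ : Fin (d + 1)) (w : Fin (d + 1) → ℤ), |colM K' N μ y ρ w| ≤ C' * Real.exp (-δ * l1 ((N : ℤ) • w - (N : ℤ) • y)) :=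
    fun ρ w => OneStepResolventKernel.bound_mono (abs_colM_le (N := N) hK' μ y ρ w) hC' le_rfl hδK (l1_nonneg _)
  have hww : ∀ (ρ : Fin (d + 1)) (w : Fin (d + 1) → ℤ),
      |colM K N μ y ρ w - colM K' N μ y ρ w| ≤ εK * Real.exp (-δ * l1 ((N : ℤ) • w - (N : ℤ) • y)) := fun ρ w => by
    have h := abs_colM_le (N := N) hKK μ y ρ w
    exact OneStepResolventKernel.bound_mono h hεK le_rfl hδK (l1_nonneg _)
  have hterm : ∀ ρ : Fin (d + 1), BiLoc (cwsum N (colM K N μ y ρ) (M ρ) - cwsum N (colM K' N μ y ρ) (M' ρ)) ((N : ℤ) • y) ((N : ℤ) • y)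
      ((εK * CM + C' * εM) * Zl (d + 1) (δ / 2)) (δ / 2) := fun ρ =>
    biLoc_cwsum_sub_self (hw ρ) (hw' ρ) (hww ρ) (fun w => hM ρ w) (fun w => hM' ρ w) (fun w => by
      simpa only [Pi.sub_apply] using hMM ρ w) hδ
  have hsum := biLoc_finset_sum (Finset.univ : Finset (Fin (d + 1))) (fun ρ _ => hterm ρ)
  simp only [Finset.sum_const, Finset.card_univ, Fintype.card_fin, nsmul_eq_mul] at hsum
  have e : (vertexOfM K N M - vertexOfM K' N M') μ y = fun x z a b => ∑ ρ : Fin (d + 1),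
      (cwsum N (colM K N μ y ρ) (M ρ) - cwsum N (colM K' N μ y ρ) (M' ρ)) x z a b := by
    funext x z a b
    simp only [vertexOfM, Pi.sub_apply, Finset.sum_sub_distrib]
  rw [e]
  exact hsum

/-- [folklore] **`dM` IS LIPSCHITZ IN `(K, S, M)`**: with the stencil rows (`LocStencil`, difference `εS`) and multiplier rows (`VertexFamily`, difference `εM`) at rate
`δ ≤ δK`: `VertexFamily (dM K N S M − dM K′ N S′ M′) N ((d+1)·((εK·Cs + C′·εS)·Zl(δ/2)) + (d+1)·((εK·CM + C′·εM)·Zl(δ/2))) (δ/2)`. -/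
theorem vertexFamily_dM_sub {K K' : MKer (d + 1) (Fib d)} {C C' εK δK : ℝ} (hK : Decays K C δK) (hK' : Decays K' C' δK)
    (hKK : Decays (K - K') εK δK)
    {S S' : Fin (d + 1) → (Fin (d + 1) → ℤ) → MKer (d + 1) (Fib d)} {Cs Cs' εS δ : ℝ}
    (hS : LocStencil S Cs δ) (hS' : LocStencil S' Cs' δ) (hSS : LocStencil (S - S') εS δ)
    {M M' : Fin (d + 1) → (Fin (d + 1) → ℤ) → MKer (d + 1) (Fib d)} {CM CM' εM : ℝ}
    (hM : VertexFamily M N CM δ) (hM' : VertexFamily M' N CM' δ) (hMM : VertexFamily (M - M') N εM δ) (hδ : 0 < δ) (hδK : δ ≤ δK) :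
    VertexFamily (dM K N S M - dM K' N S' M') N
      ((d + 1 : ℕ) * ((εK * Cs + C' * εS) * Zl (d + 1) (δ / 2)) + (d + 1 : ℕ) * ((εK * CM + C' * εM) * Zl (d + 1) (δ / 2))) (δ / 2) := by
  intro μ y
  have h1 := vertexFamily_vertexOfK_sub hK hK' hKK hS hS' hSS hδ hδK N μ y
  have h2 := vertexFamily_vertexOfM_sub hK hK' hKK hM hM' hMM hδ hδK μ y
  have h := biLoc_add h1 h2
  have e : (dM K N S M - dM K' N S' M') μ y =
      (vertexOfK K N S - vertexOfK K' N S') μ y + (vertexOfM K N M - vertexOfM K' N M') μ y := by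
    funext x z a b
    simp only [dM, Pi.sub_apply, Pi.add_apply]
    ring
  rw [e]
  exact h

end VertexM

/-! ## §2 The sandwich `−K∘V∘K` is Lipschitz in `(K, V)` -/

section Sandwich

variable {F : Type*} [Fintype F] [Nonempty F]

/-- [folklore] **THE SANDWICH IS LIPSCHITZ IN `(K, V)`**: for `K, K′` decaying at rate `m` (constants `C, C′`, difference `εK`) and kernels `V, V′` bi-localised at
`(p, q)` at rate `m` (constants `CV, CV′`, difference `εV`), the difference `−K∘V∘K − (−K′∘V′∘K′)` is bi-localised at `(p, q)` at rate `m/4` with the constant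
`|F|·(|F|·(εK·CV + C′·εV)·Zl(m/2)·C + |F|·C′·CV′·Zl(m/2)·εK)·Zl(m/4)` (linear in `(εK, εV)`). -/
theorem biLoc_sandwich_sub {K K' V V' : MKer (d + 1) F} {C C' εK CV CV' εV m : ℝ} {p q : Fin (d + 1) → ℤ}
    (hK : Decays K C m) (hK' : Decays K' C' m) (hKK : Decays (K - K') εK m) (hm : 0 < m)
    (hV : BiLoc V p q CV m) (hV' : BiLoc V' p q CV' m) (hVV : BiLoc (V - V') p q εV m) :
    BiLoc ((fun x z a b => -(comp (comp K V) K x z a b)) - fun x z a b => -(comp (comp K' V') K' x z a b)) p q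
      ((Fintype.card F : ℝ) * (((Fintype.card F : ℝ) * (εK * CV + C' * εV) * Zl (d + 1) (m / 2)) * C +
        ((Fintype.card F : ℝ) * (C' * CV') * Zl (d + 1) (m / 2)) * εK) * Zl (d + 1) (m / 4)) (m / 4) := by
  have hC : 0 ≤ C := hK.nonneg (Classical.arbitrary F)
  have hC' : 0 ≤ C' := hK'.nonneg (Classical.arbitrary F)
  have hεK : 0 ≤ εK := hKK.nonneg (Classical.arbitrary F)
  have hm2 : (0 : ℝ) ≤ m / 2 := by positivity
  have hm2' : m / 2 < m := by linarith
  -- the inner telescoping: `K∘V − K′∘V′ = (K−K′)∘V + K′∘(V−V′)`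
  have s1 : ∀ x z a b, Summable fun y => ∑ f, K x y a f * V y z f b := summable_compTerm hK hV hm2 hm2'
  have s2 : ∀ x z a b, Summable fun y => ∑ f, K' x y a f * V y z f b := summable_compTerm hK' hV hm2 hm2'
  have s3 : ∀ x z a b, Summable fun y => ∑ f, K' x y a f * V' y z f b := summable_compTerm hK' hV' hm2 hm2'
  have e1 : comp K V - comp K' V' = comp (K - K') V + comp K' (V - V') := by
    rw [comp_sub_left s1 s2, comp_sub_right s2 s3]; abel
  have hD1 : BiLoc (comp K V - comp K' V') p q
      ((Fintype.card F : ℝ) * (εK * CV) * Zl (d + 1) (m - m / 2) + (Fintype.card F : ℝ) * (C' * εV) * Zl (d + 1) (m - m / 2)) (m / 2) := by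
    rw [e1]
    exact biLoc_add (biLoc_comp_decays hKK hV hm2 hm2') (biLoc_comp_decays hK' hVV hm2 hm2')
  rw [show m - m / 2 = m / 2 by ring] at hD1
  have hKV : BiLoc (comp K V) p q ((Fintype.card F : ℝ) * (C * CV) * Zl (d + 1) (m - m / 2)) (m / 2) := biLoc_comp_decays hK hV hm2 hm2'
  have hKV' : BiLoc (comp K' V') p q ((Fintype.card F : ℝ) * (C' * CV') * Zl (d + 1) (m - m / 2)) (m / 2) := biLoc_comp_decays hK' hV' hm2 hm2'
  rw [show m - m / 2 = m / 2 by ring] at hKV hKV'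
  -- the outer telescoping: `(K∘V)∘K − (K′∘V′)∘K′ = (K∘V − K′∘V′)∘K + (K′∘V′)∘(K − K′)`
  have hBK : Bdd K C := bdd_of_decays hK hm.le
  have hBK' : Bdd K' C' := bdd_of_decays hK' hm.le
  have t1 : ∀ x z a b, Summable fun y => ∑ f, comp K V x y a f * K y z f b := fun x z a b =>
    summable_sum fun f _ => summable_slice_biLoc_bdd hKV hBK (half_pos hm) x z a f b
  have t2 : ∀ x z a b, Summable fun y => ∑ f, comp K' V' x y a f * K y z f b := fun x z a b =>
    summable_sum fun f _ => summable_slice_biLoc_bdd hKV' hBK (half_pos hm) x z a f b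
  have t3 : ∀ x z a b, Summable fun y => ∑ f, comp K' V' x y a f * K' y z f b := fun x z a b =>
    summable_sum fun f _ => summable_slice_biLoc_bdd hKV' hBK' (half_pos hm) x z a f b
  have e2 : comp (comp K V) K - comp (comp K' V') K' = comp (comp K V - comp K' V') K + comp (comp K' V') (K - K') := by
    rw [comp_sub_left t1 t2, comp_sub_right t2 t3]; abel
  -- rates for the right factors: `m/2`, then the compositions land at `m/4`
  have hK2 : Decays K C (m / 2) := decays_mono hK hC le_rfl (by linarith)
  have hKK2 : Decays (K - K') εK (m / 2) := decays_mono hKK hεK le_rfl (by linarith)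
  have hm4 : (0 : ℝ) ≤ m / 4 := by positivity
  have hm4' : m / 4 < m / 2 := by linarith
  have hA := biLoc_comp_right hD1 hK2 hm4 hm4'
  have hB := biLoc_comp_right hKV' hKK2 hm4 hm4'
  rw [show m / 2 - m / 4 = m / 4 by ring] at hA hB
  have hsum := biLoc_add hA hB
  rw [← e2] at hsum
  have e3 : ((fun x z a b => -(comp (comp K V) K x z a b)) - fun x z a b => -(comp (comp K' V') K' x z a b)) =
      fun x z a b => -((comp (comp K V) K - comp (comp K' V') K') x z a b) := by
    funext x z a b
    simp only [Pi.sub_apply]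
    ring
  rw [e3]
  intro x z a b
  refine (biLoc_neg hsum x z a b).trans (le_of_eq ?_)
  ring

end Sandwich

/-! ## §3 The derivative of the inverse is Lipschitz in `(K, S, M)` -/

section K2

variable {N : ℕ} [NeZero N]

/-- [folklore] **`K2OfK` IS LIPSCHITZ IN `(K, S, M)`** as a vertex family: for `K, K′` decaying at rate `m` (difference `εK`), stencils (`LocStencil`, rate `m`, difference
`εS`) and multiplier tables (`VertexFamily`, rate `m`, difference `εM`), `VertexFamily (K2OfK K N S M − K2OfK K′ N S′ M′) N (…) (m/8)` with a constant linear in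
`(εK, εS, εM)` — §2 at `V := dM K N S M ν y′`, `V′ := dM K′ N S′ M′ ν y′` (uniform letters `SecondOrderResponse.vertexFamily_dM`, difference §1). -/
theorem vertexFamily_K2OfK_sub {K K' : MKer (d + 1) (Fib d)} {C C' εK m : ℝ} (hK : Decays K C m) (hK' : Decays K' C' m)
    (hKK : Decays (K - K') εK m) (hm : 0 < m)
    {S S' : Fin (d + 1) → (Fin (d + 1) → ℤ) → MKer (d + 1) (Fib d)} {Cs Cs' εS : ℝ}
    (hS : LocStencil S Cs m) (hS' : LocStencil S' Cs' m) (hSS : LocStencil (S - S') εS m)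
    {M M' : Fin (d + 1) → (Fin (d + 1) → ℤ) → MKer (d + 1) (Fib d)} {CM CM' εM : ℝ}
    (hM : VertexFamily M N CM m) (hM' : VertexFamily M' N CM' m) (hMM : VertexFamily (M - M') N εM m) :
    VertexFamily (K2OfK K N S M - K2OfK K' N S' M') N
      ((Fintype.card (Fib d) : ℝ) * (((Fintype.card (Fib d) : ℝ) *
          (εK * ((d + 1 : ℕ) * (C * Cs * Zl (d + 1) (m / 2)) + (d + 1 : ℕ) * (C * CM * Zl (d + 1) (m / 2))) +
            C' * ((d + 1 : ℕ) * ((εK * Cs + C' * εS) * Zl (d + 1) (m / 2)) + (d + 1 : ℕ) * ((εK * CM + C' * εM) * Zl (d + 1) (m / 2)))) *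
          Zl (d + 1) (m / 2 / 2)) * C +
        ((Fintype.card (Fib d) : ℝ) * (C' * ((d + 1 : ℕ) * (C' * Cs' * Zl (d + 1) (m / 2)) + (d + 1 : ℕ) * (C' * CM' * Zl (d + 1) (m / 2)))) *
          Zl (d + 1) (m / 2 / 2)) * εK) * Zl (d + 1) (m / 2 / 4)) (m / 2 / 4) := by
  intro ν y'
  have hC : 0 ≤ C := hK.nonneg (Sum.inl 0)
  have hC' : 0 ≤ C' := hK'.nonneg (Sum.inl 0)
  have hεK : 0 ≤ εK := hKK.nonneg (Sum.inl 0)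
  -- the inner vertex families at rate `m/2`
  have hV := vertexFamily_dM hK hC hS hM hm le_rfl ν y'
  have hV' := vertexFamily_dM hK' hC' hS' hM' hm le_rfl ν y'
  have hVV := vertexFamily_dM_sub (N := N) hK hK' hKK hS hS' hSS hM hM' hMM hm le_rfl ν y'
  rw [Pi.sub_apply] at hVV
  -- the kernels at rate `m/2`
  have hK2 : Decays K C (m / 2) := decays_mono hK hC le_rfl (by linarith)
  have hK2' : Decays K' C' (m / 2) := decays_mono hK' hC' le_rfl (by linarith)
  have hKK2 : Decays (K - K') εK (m / 2) := decays_mono hKK hεK le_rfl (by linarith)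
  have h := biLoc_sandwich_sub hK2 hK2' hKK2 (half_pos hm) hV hV' hVV
  have e : (K2OfK K N S M - K2OfK K' N S' M') ν y' =
      ((fun x z a b => -(comp (comp K (dM K N S M ν y')) K x z a b)) -
        fun x z a b => -(comp (comp K' (dM K' N S' M' ν y')) K' x z a b)) := by
    funext x z a b
    simp only [K2OfK, Pi.sub_apply]
  rw [e]
  exact h

end K2

end Summit.QuantumFields.BalabanUV.Beta.FP.ResponseVertexLipschitz

end
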